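import Summits.BirchSwinnertonDyer.BirchSwinnertonDyer.Theorems.PrintCFramBottomClassIndexLawFiveLeEisensteinTraceForm
import Literature.NumberTheory.EllipticCurves.NewformSymmSquareTwistClass
import Literature.NumberTheory.EllipticCurves.ComplexMultiplicationShaKnappProofs
import Literature.NumberTheory.EllipticCurves.ComplexMultiplicationLocalFactors28
import Summits.BirchSwinnertonDyer.BirchSwinnertonDyer.Theorems.GoldfeldGoodTwistsSmithCaseII
import HarnessLib

/-!
# Crux `PrintCFram.BottomClassIndexLawFiveLe` (stmt-BirchSwinnertonDyer-20372), line `katz-genus-crossing`, research stub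
# `stub_heegnerFieldPPart`: the Eisenstein trace form CLASS-WIDE, on the crux's own binders —
# `HasCM W → CMRamified W p → 5 ≤ p → ∃ d ≠ 0, ∀ odd primes ℓ ∤ pd: a_ℓ(W) ≡ (d/ℓ)·(ℓ^{(p+1)/4} + ℓ^{(3p−1)/4}) (mod p)`
# (all SEVEN leaf classes, every member; cell `bsd-print-cfram`, width seat `bsd-line-cfram-p1-w2` g2; THEOREMS ONLY,
# `--supports` 20372; BSD is not proved by any of this)

HONEST FRAMING. Nothing here is a statement about BSD. This file assembles, on exactly the binders of the crux
(`W.HasCM`, `CMRamified W p`, `5 ≤ p` — the seven leaf classes `(7, −3375)`, `(7, 16581375)`, `(11, −32768)`, `(19, −884736)`,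
`(43, −884736000)`, `(67, −147197952000)`, `(163, −262537412640768000)` of `AnchorReduction.classes_of_cmRamified`), the
semisimplified residual representation of EVERY member at the CM-ramified prime:
`ρ̄_{W,p}^{ss} ≅ (ω^{(p+1)/4} ⊕ ω^{(3p−1)/4}) ⊗ χ_d` in trace form, `a_ℓ(W) ≡ (d/ℓ)(ℓ^{(p+1)/4} + ℓ^{(3p−1)/4}) (mod p)` at every odd
prime `ℓ ≠ p`, `ℓ ∤ d`, for some integer `d ≠ 0` (the twisting parameter of the member; `(d/ℓ)` the Legendre symbol). Inputs: the
leaf trace forms (cell `bsd-cm`'s `RouteU.lFunction_cm7_mod_seven` at `p = 7`, the previous w2's `lFunction_cm163_mod`, and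
`EisensteinTraceForm.lFunction_cm11/19/43/67_mod`), the `j ⟹ twist` transport
`exists_variableChange_eq_quadraticTwist_intCast_of_j_eq` (Silverman X.5.4), the twisting formula at an odd prime `ℓ ∤ d` for an
ARBITRARY integer `d` (`LFunction_quadraticTwist_intCast_apply_prime_of_not_dvd`, no reduction hypothesis), and for the class
`(7, 16581375)` (CM by `ℤ[√−7]`) the tree's Knapp-11.67 instance `LFunction_cm28_eq` (`[0,−42,0,−7,0] ~ [0,21,0,112,0] ≅ 49a1`).

* `traceForm_twist_of_smul_eq` (generic): a mod-`p` trace form of `E` transports to any `W` with `C • W = E^{(d)}` (`d ∈ ℤ`) at the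
  odd primes `ℓ ≠ p`, `ℓ ∤ d`, with the Legendre sign `(d/ℓ)`.
* `lFunction_cm28Q_mod_seven`: `a_ℓ([0,−42,0,−7,0]) ≡ ℓ² + ℓ⁵ (mod 7)` (`j = 16581375`), from `49a1` by isogeny + isomorphism
  (the curve is written as a literal; ellipticity and `j` are cell `bsd-goldfeld`'s `GoldfeldGoodTwists.isElliptic_twoTorsionNF_seven_codomain_one` / `j_twoTorsionNF_seven_codomain_one`, re-used).
* `traceForm_of_cmRamified`: the class-wide statement above.

This is the input «`E[p]^{ss} ≅ 𝔽_p(ψ) ⊕ 𝔽_p(ψ⁻¹ω)`» of every Eisenstein-prime method over a Heegner field `K''` with `p` split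
(Kriz–Li 2019 Thm. 1.20 / Route U; CGLS-type congruences; the branch character of the `GL₁`-over-the-genus-field reformulation in
`Cruxes/BottomClassIndexLawFiveLe/Lines/katz-genus-crossing-w2-lever-audit.md` §5). beyond-print theorem: NO.

References: [Mazur1978] Prop. 6.3 (1); [Gross1980] Thm. 13.1.2; [BuhlerGross1985] Ch. I (4.3); [SilvermanAEC2009] X.2 Prop. 2.4,
X.5 Prop. 5.4 / Cor. 5.4.1, Exercise 10.16; [Knapp1993] Thm. 11.67; [SilvermanATAEC1994] App. A §3.
-/

noncomputable section

-- summit-side namespace `Summit.BirchSwinnertonDyer.BirchSwinnertonDyer.…` (single-conjunct summit, D-0017 layout)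
set_option linter.dupNamespace false

open scoped Classical
open NumberField IsDedekindDomain IsDedekindDomain.HeightOneSpectrum Field WeierstrassCurve
open Literature.NumberTheory.EllipticCurves Literature.NumberTheory.GaloisRepresentations
open Literature.NumberTheory.EllipticCurves.Rank1Residual
open Summit.BirchSwinnertonDyer.Rank1Residual
open Summit.BirchSwinnertonDyer.Rank1Residual.X12.O11

namespace Summit.BirchSwinnertonDyer.BirchSwinnertonDyer.Theorems.PrintCFram.EisensteinTraceForm

/-! ## §1 Transport of a mod-`p` trace form along `C • W = E^{(d)}`, `d ∈ ℤ` arbitrary -/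

/-- **Transport along an arbitrary integral twist.** If `a_ℓ(E) ≡ ℓ^{k₁} + ℓ^{k₂} (mod p)` at every prime `ℓ ≠ p`, and
`C • W = E^{(d)}` for an integer `d`, then `a_ℓ(W) ≡ (d/ℓ)·(ℓ^{k₁} + ℓ^{k₂}) (mod p)` at every ODD prime `ℓ ≠ p` with `ℓ ∤ d`
(`(d/ℓ)` the Legendre symbol): `a_ℓ(E^{(d)}) = (d/ℓ)·a_ℓ(E)` at an odd prime `ℓ ∤ d`, no reduction hypothesis
(`LFunction_quadraticTwist_intCast_apply_prime_of_not_dvd`), and `LFunction_smul`. [cite: SilvermanAEC2009, X.2 Prop. 2.4 and Exercise 10.16] -/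
theorem traceForm_twist_of_smul_eq (E : WeierstrassCurve ℚ) [E.IsElliptic] (p k₁ k₂ : ℕ)
    (hbase : ∀ (ℓ : ℕ) [Fact ℓ.Prime], ℓ ≠ p → (E.LFunction ℓ : ZMod p) = (ℓ : ZMod p) ^ k₁ + (ℓ : ZMod p) ^ k₂)
    (W : WeierstrassCurve ℚ) [W.IsElliptic] {d : ℤ} (hW : ∃ C : VariableChange ℚ, C • W = E.quadraticTwist (d : ℚ))
    (ℓ : ℕ) [hℓ : Fact ℓ.Prime] (hℓ2 : ℓ ≠ 2) (hℓp : ℓ ≠ p) (hℓd : ¬ ((ℓ : ℤ) ∣ d)) :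
    ((W.LFunction ℓ : ℤ) : ZMod p) = (jacobiSym d ℓ : ZMod p) * ((ℓ : ZMod p) ^ k₁ + (ℓ : ZMod p) ^ k₂) := by
  obtain ⟨C, hC⟩ := hW
  have h1 : W.LFunction ℓ = (E.quadraticTwist (d : ℚ)).LFunction ℓ := by rw [← hC, LFunction_smul]
  set v : HeightOneSpectrum (𝓞 ℚ) := (Rat.HeightOneSpectrum.primesEquiv (R := 𝓞 ℚ)).symm ⟨ℓ, hℓ.out⟩ with hvdef
  have hv : (Rat.HeightOneSpectrum.primesEquiv v : ℕ) = ℓ := by rw [hvdef, Equiv.apply_symm_apply]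
  have h2 := E.LFunction_quadraticTwist_intCast_apply_prime_of_not_dvd d v (by rw [hv]; exact hℓ2)
    (by rw [hv]; exact hℓd)
  rw [hv] at h2
  rw [h1, h2]
  push_cast
  rw [hbase ℓ hℓp]

/-- `j ⟹ twist`: a member of the class of `E` (`j(W) = j(E) ∉ {0, 1728}`) is `ℚ`-isomorphic to `E^{(d)}` for a squarefree
integer `d ≠ 0`; combined with `traceForm_twist_of_smul_eq`. [cite: SilvermanAEC2009, X.5 Prop. 5.4 and Cor. 5.4.1] -/
theorem traceForm_of_j_eq (E : WeierstrassCurve ℚ) [E.IsElliptic] (p k₁ k₂ : ℕ) (h0 : E.j ≠ 0) (h1728 : E.j ≠ 1728)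
    (hbase : ∀ (ℓ : ℕ) [Fact ℓ.Prime], ℓ ≠ p → (E.LFunction ℓ : ZMod p) = (ℓ : ZMod p) ^ k₁ + (ℓ : ZMod p) ^ k₂)
    (W : WeierstrassCurve ℚ) [W.IsElliptic] (hj : W.j = E.j) :
    ∃ d : ℤ, d ≠ 0 ∧ ∀ (ℓ : ℕ) [Fact ℓ.Prime], ℓ ≠ 2 → ℓ ≠ p → ¬ ((ℓ : ℤ) ∣ d) →
      ((W.LFunction ℓ : ℤ) : ZMod p) = (jacobiSym d ℓ : ZMod p) * ((ℓ : ZMod p) ^ k₁ + (ℓ : ZMod p) ^ k₂) := by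
  obtain ⟨d, hd0, -, C, hC⟩ := exists_variableChange_eq_quadraticTwist_intCast_of_j_eq hj h0 h1728
  exact ⟨d, hd0, fun ℓ _ hℓ2 hℓp hℓd => traceForm_twist_of_smul_eq E p k₁ k₂ hbase W ⟨C, hC⟩ ℓ hℓ2 hℓp hℓd⟩

/-! ## §2 The class `(7, 16581375)` (CM by `ℤ[√−7]`): `a_ℓ ≡ ℓ² + ℓ⁵ (mod 7)` from `49a1` -/

/-- The `2`-isogenous codomain `[0, 21, 0, 112, 0]` (`j = −3375`) IS `49a1`: `⟨½, 2, −½, −1⟩ • cm7 = [0, 21, 0, 112, 0]`.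
[cite: SilvermanAEC2009, III.1 (change of variables) and III.4 Example 4.5] -/
theorem smul_cm7_eq : (⟨Units.mk0 (2⁻¹ : ℚ) (by norm_num), 2, -2⁻¹, -1⟩ : VariableChange ℚ) • cm7 =
    (⟨0, 21, 0, 112, 0⟩ : WeierstrassCurve ℚ) := by
  ext <;> norm_num [cm7, variableChange_a₁, variableChange_a₂, variableChange_a₃, variableChange_a₄, variableChange_a₆]

/-- **`a_ℓ([0, −42, 0, −7, 0]) ≡ ℓ² + ℓ⁵ (mod 7)` for every prime `ℓ ≠ 7`** (class `(7, 16581375)`): the tree's Knapp-11.67 instance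
`LFunction_cm28_eq` (`L([0,−42d,0,−7d²,0]) = L([0,21d,0,112d²,0])`, here `d = 1`), the isomorphism `[0,21,0,112,0] ≅ 49a1`
(`smul_cm7_eq`, `LFunction_smul`) and cell `bsd-cm`'s `RouteU.lFunction_cm7_mod_seven`.
[cite: Knapp1993, Thm. 11.67] [cite: Mazur1978, Prop. 6.3 (1) (p. 153)] -/
theorem lFunction_cm28Q_mod_seven (ℓ : ℕ) [hℓ : Fact ℓ.Prime] (h7 : ℓ ≠ 7) :
    (haveI := GoldfeldGoodTwists.isElliptic_twoTorsionNF_seven_codomain_one; ((⟨0, -42, 0, -7, 0⟩ : WeierstrassCurve ℚ).LFunction ℓ : ZMod 7)) =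
      (ℓ : ZMod 7) ^ 2 + (ℓ : ZMod 7) ^ 5 := by
  haveI := GoldfeldGoodTwists.isElliptic_twoTorsionNF_seven_codomain_one
  have h1 : (⟨0, -42, 0, -7, 0⟩ : WeierstrassCurve ℚ) = (cm28Model 1).map (Int.castRingHom ℚ) := by
    rw [map_cm28Model]; norm_num
  have h2 : (⟨0, 21, 0, 112, 0⟩ : WeierstrassCurve ℚ) = (cm28Codomain 1).map (Int.castRingHom ℚ) := by
    rw [map_cm28Codomain]; norm_num
  have h3 : (⟨0, -42, 0, -7, 0⟩ : WeierstrassCurve ℚ).LFunction = cm7.LFunction := by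
    rw [h1, LFunction_cm28_eq (d := 1) squarefree_one, ← h2, ← smul_cm7_eq, LFunction_smul]
  rw [h3]
  exact RouteU.lFunction_cm7_mod_seven ℓ h7

/-! ## §3 The class-wide statement on the crux's binders -/

/-- **The Eisenstein trace form at the CM-ramified prime, CLASS-WIDE.** For every elliptic `W/ℚ` with CM (`W.HasCM`), every
prime `p ≥ 5` ramified in its CM field (`CMRamified W p`, i.e. the seven leaf classes of the crux at `p ∈ {7, 11, 19, 43, 67, 163}`),
there is an integer `d ≠ 0` (the member's twisting parameter) such that for every ODD prime `ℓ ≠ p` with `ℓ ∤ d`: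
`a_ℓ(W) ≡ (d/ℓ)·(ℓ^{(p+1)/4} + ℓ^{(3p−1)/4}) (mod p)` — the trace form of `ρ̄_{W,p}^{ss} ≅ (ω^{(p+1)/4} ⊕ ω^{(3p−1)/4}) ⊗ χ_d`
(Gross LNM 776 Thm. 13.1.2 / Buhler–Gross 1985 (4.3) for `A(p)`, transported to every member). Assembled from
`AnchorReduction.classes_of_cmRamified`, the seven leaf trace forms and `traceForm_of_j_eq`.
[cite: Mazur1978, Prop. 6.3 (1) (p. 153)] [cite: BuhlerGross1985, Ch. I (4.3) (p. 14)] [cite: SilvermanAEC2009, X.5 Prop. 5.4 and Cor. 5.4.1] -/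
theorem traceForm_of_cmRamified (W : WeierstrassCurve ℚ) [W.IsElliptic] (p : ℕ) [hp : Fact p.Prime]
    (hCM : W.HasCM) (hram : CMRamified W p) (h5 : 5 ≤ p) :
    ∃ d : ℤ, d ≠ 0 ∧ ∀ (ℓ : ℕ) [Fact ℓ.Prime], ℓ ≠ 2 → ℓ ≠ p → ¬ ((ℓ : ℤ) ∣ d) →
      ((W.LFunction ℓ : ℤ) : ZMod p) =
        (jacobiSym d ℓ : ZMod p) * ((ℓ : ZMod p) ^ ((p + 1) / 4) + (ℓ : ZMod p) ^ ((3 * p - 1) / 4)) := by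
  rcases AnchorReduction.classes_of_cmRamified W hp.out hCM hram h5 with
    ⟨rfl, hj | hj⟩ | ⟨rfl, hj⟩ | ⟨rfl, hj⟩ | ⟨rfl, hj⟩ | ⟨rfl, hj⟩ | ⟨rfl, hj⟩
  · -- `(7, −3375)`: base `49a1 = cm7`
    exact traceForm_of_j_eq cm7 7 2 5 (by rw [j_cm7]; norm_num) (by rw [j_cm7]; norm_num)
      (fun ℓ _ h => RouteU.lFunction_cm7_mod_seven ℓ h) W (by rw [hj, j_cm7])
  · -- `(7, 16581375)`: base `[0, −42, 0, −7, 0]`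
    haveI := GoldfeldGoodTwists.isElliptic_twoTorsionNF_seven_codomain_one
    exact traceForm_of_j_eq (⟨0, -42, 0, -7, 0⟩ : WeierstrassCurve ℚ) 7 2 5 (by rw [GoldfeldGoodTwists.j_twoTorsionNF_seven_codomain_one]; norm_num)
      (by rw [GoldfeldGoodTwists.j_twoTorsionNF_seven_codomain_one]; norm_num)
      (fun ℓ _ h => lFunction_cm28Q_mod_seven ℓ h) W (by rw [hj, GoldfeldGoodTwists.j_twoTorsionNF_seven_codomain_one])
  · -- `(11, −32768)`
    exact traceForm_of_j_eq cm11 11 3 8 (by rw [j_cm11]; norm_num) (by rw [j_cm11]; norm_num)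
      (fun ℓ _ h => lFunction_cm11_mod ℓ h) W (by rw [hj, j_cm11])
  · -- `(19, −884736)`
    exact traceForm_of_j_eq cm19 19 5 14 (by rw [j_cm19]; norm_num) (by rw [j_cm19]; norm_num)
      (fun ℓ _ h => lFunction_cm19_mod ℓ h) W (by rw [hj, j_cm19])
  · -- `(43, −884736000)`
    exact traceForm_of_j_eq cm43 43 11 32 (by rw [j_cm43]; norm_num) (by rw [j_cm43]; norm_num)
      (fun ℓ _ h => lFunction_cm43_mod ℓ h) W (by rw [hj, j_cm43])
  · -- `(67, −147197952000)`
    exact traceForm_of_j_eq cm67 67 17 50 (by rw [j_cm67]; norm_num) (by rw [j_cm67]; norm_num)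
      (fun ℓ _ h => lFunction_cm67_mod ℓ h) W (by rw [hj, j_cm67])
  · -- `(163, −262537412640768000)`
    exact traceForm_of_j_eq cm163 163 41 122 (by rw [j_cm163]; norm_num) (by rw [j_cm163]; norm_num)
      (fun ℓ _ h => AnchorReduction.lFunction_cm163_mod ℓ h) W (by rw [hj, j_cm163])

/-! ## §4 (append, w2 g2) The prime `ℓ = 2` and the Kronecker-symbol form for `d ≡ 1 (mod 4)` — «`∀ ℓ ∤ p·N_W`»-ready -/

/-- **Transport at `ℓ = 2` for an odd fundamental twisting parameter.** If `a_ℓ(E) ≡ ℓ^{k₁} + ℓ^{k₂} (mod p)` at every prime `ℓ ≠ p`,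
`p ≠ 2`, and `C • W = E^{(d)}` with `d ≡ 1 (mod 4)`, then `a₂(W) ≡ (2/|d|)·(2^{k₁} + 2^{k₂}) (mod p)` — the unramified twist at `2`,
`a₂(E^{(d)}) = (2/|d|)·a₂(E)` with NO reduction hypothesis (`LFunction_quadraticTwist_intCast_apply_two_of_emod_four_eq_one`).
[cite: SilvermanAEC2009, X.2 Prop. 2.4 and Exercise 10.16] -/
theorem traceForm_twist_two_of_smul_eq (E : WeierstrassCurve ℚ) [E.IsElliptic] (p k₁ k₂ : ℕ) (hp2 : p ≠ 2)
    (hbase : ∀ (ℓ : ℕ) [Fact ℓ.Prime], ℓ ≠ p → (E.LFunction ℓ : ZMod p) = (ℓ : ZMod p) ^ k₁ + (ℓ : ZMod p) ^ k₂)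
    (W : WeierstrassCurve ℚ) [W.IsElliptic] {d : ℤ} (hd4 : d % 4 = 1)
    (hW : ∃ C : VariableChange ℚ, C • W = E.quadraticTwist (d : ℚ)) :
    ((W.LFunction 2 : ℤ) : ZMod p) = (jacobiSym 2 d.natAbs : ZMod p) * ((2 : ZMod p) ^ k₁ + (2 : ZMod p) ^ k₂) := by
  obtain ⟨C, hC⟩ := hW
  haveI : Fact (Nat.Prime 2) := ⟨Nat.prime_two⟩
  have h1 : W.LFunction 2 = (E.quadraticTwist (d : ℚ)).LFunction 2 := by rw [← hC, LFunction_smul]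
  set v : HeightOneSpectrum (𝓞 ℚ) := (Rat.HeightOneSpectrum.primesEquiv (R := 𝓞 ℚ)).symm ⟨2, Nat.prime_two⟩ with hvdef
  have hv : (Rat.HeightOneSpectrum.primesEquiv v : ℕ) = 2 := by rw [hvdef, Equiv.apply_symm_apply]
  have h2 := E.LFunction_quadraticTwist_intCast_apply_two_of_emod_four_eq_one hd4 v hv
  rw [h1, h2]
  push_cast
  rw [hbase 2 (Ne.symm hp2)]
  simp only [Nat.cast_ofNat]

/-- **Kronecker-symbol form at EVERY prime `ℓ ∤ pd`, for `d ≡ 1 (mod 4)`.** With `C • W = E^{(d)}`, `d ≡ 1 (mod 4)`, `p ≠ 2`: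
`a_ℓ(W) ≡ (ℓ/|d|)·(ℓ^{k₁} + ℓ^{k₂}) (mod p)` for every prime `ℓ ≠ p`, `ℓ ∤ d` — odd `ℓ` by `traceForm_twist_of_smul_eq` and the
Kronecker identity `(ℓ/|d|) = (d/ℓ)` for `d ≡ 1 (mod 4)` (`QuadraticFields.jacobiSym_natAbs_eq_of_emod_four_eq_one`), `ℓ = 2` by
`traceForm_twist_two_of_smul_eq`. This is the convention `J(ℓ | |D|)` of the odd-Heegner files (`lFunction_twist_cm…_mod`, cell
`bsd-cm`'s Route U), now WITHOUT the hypotheses «`D` squarefree, `p ∤ D`, `E` good at the primes of `D`».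
[cite: SilvermanAEC2009, X.2 Prop. 2.4 and Exercise 10.16] [cite: Cox2013, §1.C Lemma 1.14] -/
theorem traceForm_twist_kronecker_of_smul_eq (E : WeierstrassCurve ℚ) [E.IsElliptic] (p k₁ k₂ : ℕ) (hp2 : p ≠ 2)
    (hbase : ∀ (ℓ : ℕ) [Fact ℓ.Prime], ℓ ≠ p → (E.LFunction ℓ : ZMod p) = (ℓ : ZMod p) ^ k₁ + (ℓ : ZMod p) ^ k₂)
    (W : WeierstrassCurve ℚ) [W.IsElliptic] {d : ℤ} (hd4 : d % 4 = 1)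
    (hW : ∃ C : VariableChange ℚ, C • W = E.quadraticTwist (d : ℚ))
    (ℓ : ℕ) [hℓ : Fact ℓ.Prime] (hℓp : ℓ ≠ p) (hℓd : ¬ ((ℓ : ℤ) ∣ d)) :
    ((W.LFunction ℓ : ℤ) : ZMod p) = (jacobiSym ℓ d.natAbs : ZMod p) * ((ℓ : ZMod p) ^ k₁ + (ℓ : ZMod p) ^ k₂) := by
  rcases eq_or_ne ℓ 2 with rfl | hℓ2
  · exact_mod_cast traceForm_twist_two_of_smul_eq E p k₁ k₂ hp2 hbase W hd4 hW
  · have hodd : Odd ℓ := hℓ.out.odd_of_ne_two hℓ2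
    rw [Literature.NumberTheory.QuadraticFields.jacobiSym_natAbs_eq_of_emod_four_eq_one hd4 hodd]
    exact traceForm_twist_of_smul_eq E p k₁ k₂ hbase W hW ℓ hℓ2 hℓp hℓd

/-- **Class-wide, with the squarefree twisting parameter and the prime `2`.** For every member `W` of the crux's scope
(`W.HasCM`, `CMRamified W p`, `5 ≤ p`) there is a SQUAREFREE integer `d ≠ 0` with: (i) at every odd prime `ℓ ≠ p`, `ℓ ∤ d`,
`a_ℓ(W) ≡ (d/ℓ)·(ℓ^{(p+1)/4} + ℓ^{(3p−1)/4}) (mod p)`; (ii) if `d ≡ 1 (mod 4)`, then at EVERY prime `ℓ ≠ p`, `ℓ ∤ d` (including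
`ℓ = 2`) `a_ℓ(W) ≡ (ℓ/|d|)·(ℓ^{(p+1)/4} + ℓ^{(3p−1)/4}) (mod p)`. Reading for the `hss` binder of Kriz–Li Thm. 1.20 / the
Greenberg–Vatsal character pair of line `eisenstein-resource-bdp-line`: the primes of `d` and `p` divide `N_W`, and `2 ∣ N_W` unless
`d ≡ 1 (mod 4)`, so (i)+(ii) cover every prime `ℓ ∤ p·N_W`, with `ψ = χ_d·ω^{(p+1)/4}`, `ψ⁻¹ω = χ_d·ω^{(3p−1)/4}`.
[cite: Mazur1978, Prop. 6.3 (1) (p. 153)] [cite: BuhlerGross1985, Ch. I (4.3) (p. 14)] [cite: SilvermanAEC2009, X.5 Prop. 5.4 and Cor. 5.4.1] -/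
theorem traceForm_of_cmRamified_squarefree (W : WeierstrassCurve ℚ) [W.IsElliptic] (p : ℕ) [hp : Fact p.Prime]
    (hCM : W.HasCM) (hram : CMRamified W p) (h5 : 5 ≤ p) :
    ∃ d : ℤ, d ≠ 0 ∧ Squarefree d ∧
      (∀ (ℓ : ℕ) [Fact ℓ.Prime], ℓ ≠ 2 → ℓ ≠ p → ¬ ((ℓ : ℤ) ∣ d) →
        ((W.LFunction ℓ : ℤ) : ZMod p) =
          (jacobiSym d ℓ : ZMod p) * ((ℓ : ZMod p) ^ ((p + 1) / 4) + (ℓ : ZMod p) ^ ((3 * p - 1) / 4))) ∧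
      (d % 4 = 1 → ∀ (ℓ : ℕ) [Fact ℓ.Prime], ℓ ≠ p → ¬ ((ℓ : ℤ) ∣ d) →
        ((W.LFunction ℓ : ℤ) : ZMod p) =
          (jacobiSym ℓ d.natAbs : ZMod p) * ((ℓ : ZMod p) ^ ((p + 1) / 4) + (ℓ : ZMod p) ^ ((3 * p - 1) / 4))) := by
  have hp2 : p ≠ 2 := by omega
  -- one generic finishing step from a base curve `E` with trace form `(k₁, k₂)` and `j(W) = j(E) ∉ {0, 1728}`
  have finish : ∀ (E : WeierstrassCurve ℚ) [E.IsElliptic] (k₁ k₂ : ℕ), E.j ≠ 0 → E.j ≠ 1728 →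
      (∀ (ℓ : ℕ) [Fact ℓ.Prime], ℓ ≠ p → (E.LFunction ℓ : ZMod p) = (ℓ : ZMod p) ^ k₁ + (ℓ : ZMod p) ^ k₂) →
      W.j = E.j → (p + 1) / 4 = k₁ → (3 * p - 1) / 4 = k₂ →
      ∃ d : ℤ, d ≠ 0 ∧ Squarefree d ∧
        (∀ (ℓ : ℕ) [Fact ℓ.Prime], ℓ ≠ 2 → ℓ ≠ p → ¬ ((ℓ : ℤ) ∣ d) →
          ((W.LFunction ℓ : ℤ) : ZMod p) =
            (jacobiSym d ℓ : ZMod p) * ((ℓ : ZMod p) ^ ((p + 1) / 4) + (ℓ : ZMod p) ^ ((3 * p - 1) / 4))) ∧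
        (d % 4 = 1 → ∀ (ℓ : ℕ) [Fact ℓ.Prime], ℓ ≠ p → ¬ ((ℓ : ℤ) ∣ d) →
          ((W.LFunction ℓ : ℤ) : ZMod p) =
            (jacobiSym ℓ d.natAbs : ZMod p) * ((ℓ : ZMod p) ^ ((p + 1) / 4) + (ℓ : ZMod p) ^ ((3 * p - 1) / 4))) := by
    intro E _ k₁ k₂ h0 h1728 hbase hj e₁ e₂
    obtain ⟨d, hd0, hsq, C, hC⟩ := exists_variableChange_eq_quadraticTwist_intCast_of_j_eq hj h0 h1728
    refine ⟨d, hd0, hsq, fun ℓ _ hℓ2 hℓp hℓd => ?_, fun hd4 ℓ _ hℓp hℓd => ?_⟩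
    · rw [e₁, e₂]; exact traceForm_twist_of_smul_eq E p k₁ k₂ hbase W ⟨C, hC⟩ ℓ hℓ2 hℓp hℓd
    · rw [e₁, e₂]; exact traceForm_twist_kronecker_of_smul_eq E p k₁ k₂ hp2 hbase W hd4 ⟨C, hC⟩ ℓ hℓp hℓd
  rcases AnchorReduction.classes_of_cmRamified W hp.out hCM hram h5 with
    ⟨rfl, hj | hj⟩ | ⟨rfl, hj⟩ | ⟨rfl, hj⟩ | ⟨rfl, hj⟩ | ⟨rfl, hj⟩ | ⟨rfl, hj⟩
  · exact finish cm7 2 5 (by rw [j_cm7]; norm_num) (by rw [j_cm7]; norm_num)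
      (fun ℓ _ h => RouteU.lFunction_cm7_mod_seven ℓ h) (by rw [hj, j_cm7]) (by norm_num) (by norm_num)
  · haveI := GoldfeldGoodTwists.isElliptic_twoTorsionNF_seven_codomain_one
    exact finish (⟨0, -42, 0, -7, 0⟩ : WeierstrassCurve ℚ) 2 5
      (by rw [GoldfeldGoodTwists.j_twoTorsionNF_seven_codomain_one]; norm_num)
      (by rw [GoldfeldGoodTwists.j_twoTorsionNF_seven_codomain_one]; norm_num)
      (fun ℓ _ h => lFunction_cm28Q_mod_seven ℓ h) (by rw [hj, GoldfeldGoodTwists.j_twoTorsionNF_seven_codomain_one])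
      (by norm_num) (by norm_num)
  · exact finish cm11 3 8 (by rw [j_cm11]; norm_num) (by rw [j_cm11]; norm_num)
      (fun ℓ _ h => lFunction_cm11_mod ℓ h) (by rw [hj, j_cm11]) (by norm_num) (by norm_num)
  · exact finish cm19 5 14 (by rw [j_cm19]; norm_num) (by rw [j_cm19]; norm_num)
      (fun ℓ _ h => lFunction_cm19_mod ℓ h) (by rw [hj, j_cm19]) (by norm_num) (by norm_num)
  · exact finish cm43 11 32 (by rw [j_cm43]; norm_num) (by rw [j_cm43]; norm_num)
      (fun ℓ _ h => lFunction_cm43_mod ℓ h) (by rw [hj, j_cm43]) (by norm_num) (by norm_num)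
  · exact finish cm67 17 50 (by rw [j_cm67]; norm_num) (by rw [j_cm67]; norm_num)
      (fun ℓ _ h => lFunction_cm67_mod ℓ h) (by rw [hj, j_cm67]) (by norm_num) (by norm_num)
  · exact finish cm163 41 122 (by rw [j_cm163]; norm_num) (by rw [j_cm163]; norm_num)
      (fun ℓ _ h => AnchorReduction.lFunction_cm163_mod ℓ h) (by rw [hj, j_cm163]) (by norm_num) (by norm_num)

end Summit.BirchSwinnertonDyer.BirchSwinnertonDyer.Theorems.PrintCFram.EisensteinTraceForm

end
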